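import Literature.NumberTheory.Sieve.MatomakiRadziwill
import Mathlib.MeasureTheory.Integral.IntervalIntegral.Basic
import HarnessLib

/-!
# Matomäki–Radziwiłł 2016: the remaining inputs of Proposition 1 (Lemmas 3, 11, 13) as named facts

Topic `NumberTheory/Sieve`.  `MatomakiRadziwill2016_prop1` (`MatomakiRadziwill.lean`; Proposition 1 of
Matomäki–Radziwiłł, Ann. of Math. 183 (2016), §8) is, after `MatomakiRadziwill2016_lemma14_real`
(proved, `MatomakiRadziwillLemma14.lean`) and `MatomakiRadziwill2016_lemma4` (reduced to
Granville–Soundararajan, `MatomakiRadziwillLemma4Lipschitz.lean`), the last named-fact input below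
`Literature.NumberTheory.Sieve.matomaki_radziwill` (parity.S38).  Its printed proof (§8, 3½ pages) combines the
Dirichlet-polynomial toolkit of §4 — Lemma 6 (mean value theorem; the weak form
`MatomakiRadziwill2016_lemma6_weak` is proved in `DirichletPolynomialMeanValue.lean`), Lemma 7 and
Lemma 9 (named facts there), Lemma 8 (proved, `DirichletPolynomialLargeValues.lean`), Lemma 10
(duality, proved) — with four further statements, recorded here as named facts with their printed
hypotheses:

* `MatomakiRadziwill2016_lemma3` — Lemma 3 (Halász bound for the polynomial `R(s)` weighted by
  `1/(#{p ∈ [P,Q] : p ∣ n} + 1)`; proved in the paper from Halász's theorem, Lemma 2 and a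
  smooth-number estimate).
* `MatomakiRadziwill2016_lemma11` — Lemma 11 (Halász inequality for primes; proved in the paper from
  duality, an explicit formula with a smooth weight and the Vinogradov–Korobov zero-free region).
* `MatomakiRadziwill2016_lemma13` — Lemma 13 (moment computation `∫_{-T}^{T} |Q^ℓ A|²`; proved in the
  paper from Lemma 6 and Shiu's theorem on sums of multiplicative functions).

* `MatomakiRadziwill2016_lemma12` — Lemma 12 (the Ramaré–Buchstab-type decomposition, with the block
  polynomials `blockPrimePoly` = `Q_{v,H}` and `blockCofactorPoly` = `R_{v,H}`; proved in the paper from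
  Lemma 6 and Cauchy–Schwarz).  **This rendering is MIS-PARENTHESISED and FALSE as written**: the body
  of its `∫ t in 𝒯,` runs on over `+ (T + X) / X * (…)`, so the whole right-hand side carries the factor
  `H log(Q/P)` and vanishes at `Q = P`.  It is REFUTED by `not_MatomakiRadziwill2016_lemma12`; the
  correctly parenthesised statement is `MatomakiRadziwill2016_lemma12_decomp`, PROVED as
  `MatomakiRadziwill2016_lemma12_decomp_holds` — all three in `MatomakiRadziwillLemma12.lean` (which
  imports this file, so they are not restated here).  The def below is kept byte-for-byte (append-only
  tree; its negation is a theorem downstream) and must not be taken as a hypothesis.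

The assembly of §8 is the subject of later files.

## Conventions (as in `DirichletPolynomialMeanValue.lean`)

Integers of a real interval `[u, v]` are `Finset.Icc ⌈u⌉₊ ⌊v⌋₊`, primes of it are obtained by
`.filter Nat.Prime`; a finite set `𝒯 : Finset ℝ` is *well-spaced* when `|t - t'| ≥ 1` for distinct
members (§4, "for the rest of the paper we say that `𝒯 ⊆ ℝ` is well-spaced if `|t-r| ≥ 1` for all
distinct `t, r ∈ 𝒯`"), and `𝒯 ⊂ [-T, T]` is `∀ t ∈ 𝒯, |t| ≤ T`; `n^{-s}` at `s = 1 + it` is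
`(n : ℂ) ^ (-(1 + t I))`, at `s = it` it is `(n : ℂ) ^ (-(t I))`; "`≪`" with an absolute implied
constant is `∃ C` outermost, "`≪_A`" is `∀ A, ∃ C`.

## References

* K. Matomäki, M. Radziwiłł, *Multiplicative functions in short intervals*, Ann. of Math. (2) 183
  (2016), 1015–1056, doi:10.4007/annals.2016.183.3.6 (arXiv:1501.04585): Lemma 3 (§3, arXiv p. 9),
  Lemma 11 (§4, arXiv pp. 11–12), Lemma 12 (§5, arXiv p. 13), Lemma 13 (§6, arXiv p. 14),
  Proposition 1 (§8).
-/

noncomputable section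

open Finset Complex MeasureTheory

namespace Literature.NumberTheory.Sieve

/-- The number of primes of `[P, Q]` dividing `n` (the weight `1/(#{P ≤ p ≤ Q : p ∣ n} + 1)` of Lemmas 3
and 12 of Matomäki–Radziwiłł). [cite: MatomakiRadziwillAnnals2016, Lemma 3] -/
def primeDivisorsIn (P Q : ℝ) (n : ℕ) : ℕ :=
  ((Icc ⌈P⌉₊ ⌊Q⌋₊).filter (fun p => p.Prime ∧ p ∣ n)).card

/-- The weight is at most the number of integers of `[P, Q]`. [folklore] -/
theorem primeDivisorsIn_le (P Q : ℝ) (n : ℕ) : primeDivisorsIn P Q n ≤ (Icc ⌈P⌉₊ ⌊Q⌋₊).card :=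
  Finset.card_filter_le _ _

/-- `primeDivisorsIn P Q 1 = 0` (no prime divides `1`). [folklore] -/
theorem primeDivisorsIn_one (P Q : ℝ) : primeDivisorsIn P Q 1 = 0 := by
  rw [primeDivisorsIn, Finset.card_eq_zero, Finset.filter_eq_empty_iff]
  rintro p - ⟨hp, hdvd⟩
  exact hp.one_lt.ne' (Nat.dvd_one.1 hdvd)

/-- NAMED FACT — **Matomäki–Radziwiłł 2016, Lemma 3**, as printed: "Let `X ≥ Q ≥ P ≥ 2`. Let `f(n)` be a
real-valued multiplicative function and `R(s) = ∑_{X ≤ n ≤ 2X} f(n) n^{-s} · 1/(#{p ∈ [P, Q] : p ∣ n} + 1)`.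
Then for any `t ∈ [(log X)^{1/16}, X^A]`,
`|R(1+it)| ≪ (log Q)/((log X)^{1/16} log P) + log X · exp(-(log X)/(3 log Q) · log((log X)/(log Q)))`."
The function is `f : ℕ → [-1,1]` (the standing assumption of §3, made explicit: `|f n| ≤ 1`), `A > 0` is
fixed and the implied constant depends on `A` only (`∀ A, ∃ C`).
Users take `(h : MatomakiRadziwill2016_lemma3)`. [cite: MatomakiRadziwillAnnals2016, Lemma 3] -/
def MatomakiRadziwill2016_lemma3 : Prop :=
  ∀ A : ℝ, 0 < A → ∃ C : ℝ, ∀ f : ArithmeticFunction ℝ, f.IsMultiplicative → (∀ n, |f n| ≤ 1) →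
    ∀ X P Q t : ℝ, 2 ≤ P → P ≤ Q → Q ≤ X → Real.log X ^ (1 / 16 : ℝ) ≤ t → t ≤ X ^ A →
      ‖∑ n ∈ Icc ⌈X⌉₊ ⌊2 * X⌋₊,
          (f n : ℂ) * (n : ℂ) ^ (-(1 + (t : ℂ) * I)) / ((primeDivisorsIn P Q n : ℂ) + 1)‖ ≤
        C * (Real.log Q / (Real.log X ^ (1 / 16 : ℝ) * Real.log P)
          + Real.log X * Real.exp (-(Real.log X / (3 * Real.log Q)) * Real.log (Real.log X / Real.log Q)))

/-- NAMED FACT — **Matomäki–Radziwiłł 2016, Lemma 11** (Halász inequality for primes), as printed: "Let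
`P(s) = ∑_{P ≤ p ≤ 2P} a_p p^{-s}` be a Dirichlet polynomial whose coefficients are supported on the primes
and let `𝒯 ⊂ [-T, T]` be a sequence of well-spaced points. Then
`∑_{t ∈ 𝒯} |P(it)|² ≪ (P + |𝒯| P exp(-(log P)/(log T)^{2/3+ε}) (log T)²) · ∑_{P ≤ p ≤ 2P} |a_p|²/log P`."
Here `ε > 0` is fixed and the implied constant may depend on it (`∀ ε, ∃ C`); `P ≥ 2`, `T ≥ 2` (so that
`log P, log T > 0`; tacit in the paper).
Users take `(h : MatomakiRadziwill2016_lemma11)`. [cite: MatomakiRadziwillAnnals2016, Lemma 11] -/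
def MatomakiRadziwill2016_lemma11 : Prop :=
  ∀ ε : ℝ, 0 < ε → ∃ C : ℝ, ∀ (P T : ℝ) (a : ℕ → ℂ) (𝒯 : Finset ℝ), 2 ≤ P → 2 ≤ T →
    (∀ t ∈ 𝒯, |t| ≤ T) → (∀ t ∈ 𝒯, ∀ t' ∈ 𝒯, t ≠ t' → 1 ≤ |t - t'|) →
    ∑ t ∈ 𝒯, ‖∑ p ∈ (Icc ⌈P⌉₊ ⌊2 * P⌋₊).filter Nat.Prime, a p * (p : ℂ) ^ (-((t : ℂ) * I))‖ ^ 2 ≤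
      C * (P + (𝒯.card : ℝ) * P * Real.exp (-(Real.log P / Real.log T ^ (2 / 3 + ε))) * Real.log T ^ 2)
        * ∑ p ∈ (Icc ⌈P⌉₊ ⌊2 * P⌋₊).filter Nat.Prime, ‖a p‖ ^ 2 / Real.log P

/-- NAMED FACT — **Matomäki–Radziwiłł 2016, Lemma 13** (moment computation), as printed (§6: "Let
`Y₁, Y₂ ≥ 1`, and consider `Q(s) = ∑_{Y₁ ≤ p ≤ 2Y₁} c_p p^{-s}` and `A(s) = ∑_{X/Y₂ ≤ m ≤ 2X/Y₂} a_m m^{-s}`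
with coefficients `|a_m|, |c_p| ≤ 1`.  Lemma 13. Let `ℓ = ⌈(log Y₂)/(log Y₁)⌉`. Then
`∫_{-T}^{T} |Q(1+it)^ℓ · A(1+it)|² dt ≪ (T/X + 2^ℓ Y₁) · ((ℓ+1)!)²`").  Absolute implied constant
(`∃ C`); `Y₁ ≥ 2` (the sum over `p` runs over primes, and `log Y₁ > 0` is needed for `ℓ`; tacit),
`Y₂ ≥ 1`, `X ≥ 1`, `T ≥ 1` made explicit; `ℓ` is `⌈log Y₂/log Y₁⌉₊`.
Users take `(h : MatomakiRadziwill2016_lemma13)`. [cite: MatomakiRadziwillAnnals2016, Lemma 13] -/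
def MatomakiRadziwill2016_lemma13 : Prop :=
  ∃ C : ℝ, ∀ (X T Y₁ Y₂ : ℝ) (a c : ℕ → ℂ), 1 ≤ X → 1 ≤ T → 2 ≤ Y₁ → 1 ≤ Y₂ →
    (∀ m, ‖a m‖ ≤ 1) → (∀ p, ‖c p‖ ≤ 1) →
    ∫ t in (-T)..T,
        ‖(∑ p ∈ (Icc ⌈Y₁⌉₊ ⌊2 * Y₁⌋₊).filter Nat.Prime, c p * (p : ℂ) ^ (-(1 + (t : ℂ) * I)))
              ^ ⌈Real.log Y₂ / Real.log Y₁⌉₊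
          * ∑ m ∈ Icc ⌈X / Y₂⌉₊ ⌊2 * X / Y₂⌋₊, a m * (m : ℂ) ^ (-(1 + (t : ℂ) * I))‖ ^ 2 ≤
      C * (T / X + 2 ^ ⌈Real.log Y₂ / Real.log Y₁⌉₊ * Y₁)
        * ((⌈Real.log Y₂ / Real.log Y₁⌉₊ + 1).factorial : ℝ) ^ 2

/-- The prime-block polynomial of Lemma 12: `Q_{v,H}(s) = ∑_{P ≤ p ≤ Q, e^{v/H} ≤ p < e^{(v+1)/H}} c_p p^{-s}`
at `s = 1 + it`.  The printed statement of Lemma 12 writes the block condition with `≤` at both ends; its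
proof ("we split the first sum further into dyadic ranges … `e^{j/H} ≤ p < e^{(j+1)/H}`") and the
requirement that the blocks partition the primes of `[P, Q]` dictate the half-open reading used here.
[cite: MatomakiRadziwillAnnals2016, Lemma 12] -/
def blockPrimePoly (c : ℕ → ℂ) (P Q H : ℝ) (v : ℕ) (t : ℝ) : ℂ :=
  ∑ p ∈ ((Icc ⌈P⌉₊ ⌊Q⌋₊).filter Nat.Prime).filter
      (fun p : ℕ => Real.exp (v / H) ≤ p ∧ (p : ℝ) < Real.exp ((v + 1) / H)),
    c p * (p : ℂ) ^ (-(1 + (t : ℂ) * I))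

/-- The cofactor polynomial of Lemma 12:
`R_{v,H}(s) = ∑_{X e^{-v/H} ≤ m ≤ 2X e^{-v/H}} b_m m^{-s} / (#{P ≤ q ≤ Q prime : q ∣ m} + 1)` at `s = 1 + it`.
[cite: MatomakiRadziwillAnnals2016, Lemma 12] -/
def blockCofactorPoly (b : ℕ → ℂ) (X P Q H : ℝ) (v : ℕ) (t : ℝ) : ℂ :=
  ∑ m ∈ Icc ⌈X * Real.exp (-(v / H))⌉₊ ⌊2 * X * Real.exp (-(v / H))⌋₊,
    b m * (m : ℂ) ^ (-(1 + (t : ℂ) * I)) / ((primeDivisorsIn P Q m : ℂ) + 1)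

/-- **MIS-STATED (mis-parenthesised, provably FALSE) — do not use; superseded by
`MatomakiRadziwill2016_lemma12_decomp` / `MatomakiRadziwill2016_lemma12_decomp_holds` (PROVED) and
refuted by `not_MatomakiRadziwill2016_lemma12`, all in `MatomakiRadziwillLemma12.lean`.**
Intended content — **Matomäki–Radziwiłł 2016, Lemma 12** (the Ramaré–Buchstab-type decomposition), as
printed: "Let `H ≥ 1` and `Q ≥ P ≥ 1`. Let `a_m`, `b_m` and `c_p` be bounded sequences such that
`a_{mp} = b_m c_p` whenever `p ∤ m` and `P ≤ p ≤ Q`. Let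
`Q_{v,H}(s) = ∑_{P ≤ p ≤ Q, e^{v/H} ≤ p ≤ e^{(v+1)/H}} c_p p^{-s}` and
`R_{v,H}(s) = ∑_{Xe^{-v/H} ≤ m ≤ 2Xe^{-v/H}} b_m m^{-s} · 1/(#{P ≤ q ≤ Q : q ∣ m, q ∈ ℙ} + 1)`,
and let `𝒯 ⊆ [-T, T]`. Then
`∫_𝒯 |∑_{X ≤ n ≤ 2X} a_n n^{-1-it}|² dt ≪ H log(Q/P) × ∑_{j ∈ ℐ} ∫_𝒯 |Q_{j,H}(1+it) R_{j,H}(1+it)|² dt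
  + (T+X)/X · (1/H + 1/P + ∑_{X ≤ n ≤ 2X, (n, ∏_{P ≤ p ≤ Q} p) = 1} |a_n|²/n)`,
where `ℐ` is the interval `⌊H log P⌋ ≤ j ≤ H log Q`."  Renderings: "bounded" = bounded by `1` (the
implied constant is then absolute, `∃ C`); `𝒯` is a measurable subset of `[-T, T]`, `T ≥ 1`, `X ≥ 1`;
`j` runs over the natural numbers of `[⌊H log P⌋, H log Q]` (`H log P ≥ 0`); the prime blocks are
half-open (see `blockPrimePoly`); `(n, ∏ p) = 1` is "no prime of `[P, Q]` divides `n`".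
DEFECT of the Lean term below: Mathlib's `∫ t in 𝒯, body` parses `body` at precedence 60, below that
of `+`, so the integrand is `‖Q_j R_j‖ ^ 2 + (T + X) / X * (…)` and the right-hand side is
`C · H log(Q/P) · ∑_j ∫_𝒯 (|Q_j R_j|² + (T+X)/X · (…)) dt` instead of the printed
`C · (H log(Q/P) · ∑_j ∫_𝒯 |Q_j R_j|² dt + (T+X)/X · (…))`; with `X = T = H = 1`, `P = Q = 2`,
`a = b = c = 1`, `𝒯 = [-1, 1]` the right side is `0` and the left side is `≥ 1/2`
(`not_MatomakiRadziwill2016_lemma12`).  Users take `(h : MatomakiRadziwill2016_lemma12_decomp)` or use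
the proved `MatomakiRadziwill2016_lemma12_decomp_holds` instead.
[cite: MatomakiRadziwillAnnals2016, Lemma 12] -/
def MatomakiRadziwill2016_lemma12 : Prop :=
  ∃ C : ℝ, ∀ (X T P Q H : ℝ) (a b c : ℕ → ℂ) (𝒯 : Set ℝ), 1 ≤ X → 1 ≤ T → 1 ≤ P → P ≤ Q → 1 ≤ H →
    (∀ n, ‖a n‖ ≤ 1) → (∀ m, ‖b m‖ ≤ 1) → (∀ p, ‖c p‖ ≤ 1) →
    (∀ m p : ℕ, p.Prime → P ≤ p → (p : ℝ) ≤ Q → ¬ p ∣ m → a (m * p) = b m * c p) →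
    MeasurableSet 𝒯 → 𝒯 ⊆ Set.Icc (-T) T →
    ∫ t in 𝒯, ‖∑ n ∈ Icc ⌈X⌉₊ ⌊2 * X⌋₊, a n * (n : ℂ) ^ (-(1 + (t : ℂ) * I))‖ ^ 2 ≤
      C * (H * Real.log (Q / P) *
              ∑ j ∈ Icc ⌊H * Real.log P⌋₊ ⌊H * Real.log Q⌋₊,
                ∫ t in 𝒯, ‖blockPrimePoly c P Q H j t * blockCofactorPoly b X P Q H j t‖ ^ 2
            + (T + X) / X * (1 / H + 1 / P
                + ∑ n ∈ (Icc ⌈X⌉₊ ⌊2 * X⌋₊).filter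
                    (fun n : ℕ => ∀ p ∈ (Icc ⌈P⌉₊ ⌊Q⌋₊).filter Nat.Prime, ¬ p ∣ n),
                    ‖a n‖ ^ 2 / n))


end Literature.NumberTheory.Sieve
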